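import Summits.CriticalPhenomena.CardyFormulaZ2.Theses.CardyCapacityWard
import Literature.Probability.RandomPlanarGeometry.ImageUnivalent
import Literature.Probability.RandomPlanarGeometry.ConformalRectangleProofs

/-!
# Birth skeleton (BC3) for the crux `TubeReduction` — stmt-CriticalPhenomena-4622

Route `CardyCapacityWard` (route-CriticalPhenomena-CardyCapacityWard), crux rank 4:

  `TubeReduction : FlatMarkedCovariance → ∃ f : ℝ → ℝ, ∀ R : ConformalRectangle,
      R.HasCrossingLimit (bondDomainCrossingProb R) f`

— crossing limits with ONE continuous `f` for the FLAT-MARKED conformal rectangles (carrier in `ℍ`,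
an upper half-ball around each of the four marks inside the domain) give crossing limits with the
same `f` for ALL conformal rectangles (the `X_U` shape that `CardyRigidity` consumes).

## The line (tube surgery, as filed on the crux) and its two registered stubs

Fix `R`, a uniformizing datum `(φ, x)` of `R`, `η = crossRatio x ∈ (0,1)` and the flat-marked limit
function `f` (continuous on `(0,1)`).

* `stub_tubeSurgery` (RSW one-arm surgery at the marks + Carathéodory/Radó continuity of the
  modulus; the NAMED MECHANISM of the crux, size L). For a rectangle whose CLOSURE lies in the open
  upper half-plane and every `ε > 0` there is a flat-marked rectangle `R'` (hang from each mark a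
  thin tube down to the real axis, new marks at the tube bottoms) such that (i) every uniformizing
  datum of `R'` has cross-ratio within `ε` of `η` (thin tubes move the modulus little: harmonic
  measure / extremal length; by `crossRatio_eq_of_isUniformizing_holds` it is enough to control ONE
  datum) and (ii) for all small `δ` the bond-`ℤ²` crossing probabilities of `R` and `R'` differ by at
  most `ε` (the two crossing events differ only on a one-arm event from scale `w` (tube width) to
  scale `O(1)` at one of the four marks, RSW `rsw_half`; plus the G02 discretisation bookkeeping:
  largest component and closest-arc rule agree away from the tubes for `δ ≤ δ₀(w)`).
  Purely a COMPARISON statement: it assumes no limit and produces none.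
* `stub_translate` (sub-mesh translation robustness of crossing limits; the risk the crux's
  `why it might fail` names, size M–L). If the crossing probabilities of the translate `R + v`
  converge as `δ → 0⁺`, so do those of `R`, to the same limit. Exact for `v ∈ δℤ²`
  (lattice invariance of `discreteCrossing`); the content is the jitter `|v - δ[v/δ]| ≤ δ` for a
  FIXED Jordan domain with arbitrary (possibly wild) boundary. It is needed because the flat-marked
  class is anchored to `ℍ` and a rectangle containing `0` has no `δ`-independent lattice-symmetric
  image inside `ℍ`; it is a CONSEQUENCE of `X_U` (hence of `CardyFormulaZ2`), so refuting it refutes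
  the sub-problem as typed.

Composition `TubeReduction_of` (real proof, no `sorry`): take `f` from `FlatMarkedCovariance`.
(1) For `S` with `closure S ⊆ ℍ` and a datum `(ψ, y)`: `ε/3`-argument — continuity of `f` at
`η = crossRatio y` gives `θ`; `stub_tubeSurgery` with `min (θ/2) (ε/3)` gives `R'`; `R'` has a
uniformizing datum (`MarkedDomain.exists_isUniformizing_holds`, PROVED in the tree: Riemann mapping +
Carathéodory), so `FlatMarkedCovariance` gives `P_δ(R') → f(η')` with `|η' - η| < θ`; hence eventually
`|P_δ(S) - f(η)| < ε`. (2) For arbitrary `R` with datum `(φ, x)`: translate by `v = (r+1)i`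
(`closure R ⊆ B̄(0,r)`), `MarkedDomain.translate R v` has closure in `ℍ`
(`closure_image_of_isBounded`) and the transported datum `((· + v) ∘ φ, x)`
(`IsUniformizing.image_data`, same `x`), so (1) gives `P_δ(R + v) → f(crossRatio x)` and
`stub_translate` transfers it to `R`.

Device (D-0027 §3.3, as in `Cruxes/CardyRigidity/Lines/birth.lean`): each stub is a sorried theorem
`Holds.stub_<name> : <full statement over tree declarations>` (registered under the short name
`stub_<name>` with that text) plus the by-name handle `def stub_<name> : Prop := type_of% Holds.stub_<name>`;
the hypotheses of `TubeReduction_of` are exactly these two handles, by name, and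
`TubeReduction_proof` certifies mechanically that the handles ARE the stub statements.

BC3 probes (run in a separate file WITHOUT the sorried theorems in scope, `bc/TubeReduction_probes.lean`
in the registrar's folder): for each stub, `stub → TubeReduction` and `stub → CardyFormulaZ2` by
`first | exact? | simpa [stub] | (unfold stub; simpa) | aesop` FAIL (4/4), and `stub` itself is not
closed by `exact?`/`simp`/`aesop` (2/2) — see the registrar's NOTES.md for the raw outputs.

Disproof used: none — `ledger crux ls stmt-CriticalPhenomena-4622` shows no `Disproof.lean`
(2026-08-17); negatives index of the summit: stmt-CriticalPhenomena-0772 (SAW parafermion tightness)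
and the `CardyUniqueLimit.NegDegenerateArcs` refutation (stmt-0748, degenerate arcs) — neither is
assumed: both stubs speak about genuine conformal rectangles (four distinct marks, Jordan arcs).
-/

noncomputable section

namespace Summit.CriticalPhenomena.CardyFormulaZ2.Cruxes.TubeReduction.Birth

open scoped Topology
open Set Filter
open Literature.Probability.RandomPlanarGeometry Literature.Probability.Percolation
open UpperHalfPlane (upperHalfPlaneSet)
open Summit.CriticalPhenomena.CardyFormulaZ2.Theses.CardyCapacityWard (FlatMarkedCovariance TubeReduction)

/-! ### The two registered stubs (the ONLY `sorry`s of this file) and their by-name handles -/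

/-- **Stub A — sub-mesh translation robustness of crossing limits.** If the bond-`ℤ²` crossing
probabilities of the translate `R + v` of a conformal rectangle converge as the mesh `δ → 0⁺`, then
those of `R` converge to the same limit. Exact for lattice vectors `v ∈ δℤ²`; the content is the
sub-mesh jitter for a fixed Jordan domain with arbitrary boundary (largest-component / closest-arc
discretisation of G02). A consequence of `X_U`; needed because the flat-marked class is anchored to
`ℍ`. Size M–L. -/
protected theorem Holds.stub_translate : ∀ (R : Literature.Probability.RandomPlanarGeometry.ConformalRectangle) (v : ℂ) (L : ℝ), Filter.Tendsto (Literature.Probability.Percolation.bondDomainCrossingProb (Literature.Probability.RandomPlanarGeometry.MarkedDomain.translate R v)) (nhdsWithin 0 (Set.Ioi 0)) (nhds L) → Filter.Tendsto (Literature.Probability.Percolation.bondDomainCrossingProb R) (nhdsWithin 0 (Set.Ioi 0)) (nhds L) := by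
  sorry

/-- By-name handle of the registered stub `Holds.stub_translate`. -/
def stub_translate : Prop := type_of% Holds.stub_translate

/-- **Stub B — tube surgery (flat-marked `ε`-approximants above the real axis).** For a conformal
rectangle whose closure lies in the open upper half-plane, a uniformizing datum `(φ, x)` and
`ε > 0`, there is a FLAT-MARKED conformal rectangle `R'` (carrier in `ℍ`, an upper half-ball around
each mark inside the domain) all of whose uniformizing data have cross-ratio within `ε` of
`crossRatio x`, and whose bond-`ℤ²` crossing probabilities are, for all small `δ`, within `ε` of
those of `R` (thin tubes from the marks down to `ℝ`: RSW one-arm bounds at the four marks +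
Carathéodory/Radó continuity of the modulus + G02 discretisation bookkeeping). Size L. -/
protected theorem Holds.stub_tubeSurgery : ∀ (R : Literature.Probability.RandomPlanarGeometry.ConformalRectangle), closure R.carrier ⊆ UpperHalfPlane.upperHalfPlaneSet → ∀ (φ : Literature.Probability.RandomPlanarGeometry.ConformalEquiv UpperHalfPlane.upperHalfPlaneSet R.carrier) (x : Fin 4 → ℝ), R.IsUniformizing φ x → ∀ ε : ℝ, 0 < ε → ∃ R' : Literature.Probability.RandomPlanarGeometry.ConformalRectangle, R'.carrier ⊆ UpperHalfPlane.upperHalfPlaneSet ∧ (∀ i, ∃ ρ > 0, Metric.ball (R'.pt i) ρ ∩ UpperHalfPlane.upperHalfPlaneSet ⊆ R'.carrier) ∧ (∀ (φ' : Literature.Probability.RandomPlanarGeometry.ConformalEquiv UpperHalfPlane.upperHalfPlaneSet R'.carrier) (x' : Fin 4 → ℝ), R'.IsUniformizing φ' x' → |Literature.Probability.RandomPlanarGeometry.crossRatio x' - Literature.Probability.RandomPlanarGeometry.crossRatio x| ≤ ε) ∧ (∀ᶠ δ in nhdsWithin 0 (Set.Ioi 0), |Literature.Probability.Percolation.bondDomainCrossingProb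 R δ - Literature.Probability.Percolation.bondDomainCrossingProb R' δ| ≤ ε) := by
  sorry

/-- By-name handle of the registered stub `Holds.stub_tubeSurgery`. -/
def stub_tubeSurgery : Prop := type_of% Holds.stub_tubeSurgery

/-! ### Composition (sorry-free): the two stubs imply the crux BY NAME -/

/-- **The composition (real proof).** `f` := the flat-marked limit function. Rectangles with closure
in `ℍ`: `ε/3`-argument from `stub_tubeSurgery`, continuity of `f` on `(0,1)`, existence of
uniformizing data for the approximant (`exists_isUniformizing_holds`) and `FlatMarkedCovariance`.
General rectangles: translate upwards (`MarkedDomain.translate`, transported datum with the same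
boundary preimages by `IsUniformizing.image_data`) and pull the limit back with `stub_translate`. -/
theorem TubeReduction_of :
    stub_translate → stub_tubeSurgery →
      Summit.CriticalPhenomena.CardyFormulaZ2.Theses.CardyCapacityWard.TubeReduction := by
  intro hT hS
  dsimp only [stub_translate, stub_tubeSurgery] at hT hS
  intro hX
  obtain ⟨f, hfc, hflat⟩ := hX
  refine ⟨f, ?_⟩
  -- Step 1: rectangles whose closure lies in the open upper half-plane.
  have key : ∀ S : ConformalRectangle, closure S.carrier ⊆ upperHalfPlaneSet →
      S.HasCrossingLimit (bondDomainCrossingProb S) f := by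
    intro S hSH ψ y hψ
    have hη : crossRatio y ∈ Set.Ioo (0 : ℝ) 1 :=
      ConformalRectangle.crossRatio_mem_Ioo_of_isUniformizing hψ
    rw [Metric.tendsto_nhds]
    intro ε hε
    obtain ⟨θ, hθ, hθf⟩ := Metric.continuousWithinAt_iff.1 (hfc _ hη) (ε / 3) (by positivity)
    obtain ⟨R', hR'H, hR'flat, hcr, hprob⟩ :=
      hS S hSH ψ y hψ (min (θ / 2) (ε / 3)) (lt_min (by positivity) (by positivity))
    obtain ⟨φ', x', hφ'⟩ := MarkedDomain.exists_isUniformizing_holds R'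
    have hlim' : Filter.Tendsto (bondDomainCrossingProb R') (nhdsWithin 0 (Set.Ioi 0))
        (nhds (f (crossRatio x'))) :=
      hflat R' hR'H hR'flat φ' x' hφ'
    have hη' : crossRatio x' ∈ Set.Ioo (0 : ℝ) 1 :=
      ConformalRectangle.crossRatio_mem_Ioo_of_isUniformizing hφ'
    have hfclose : dist (f (crossRatio x')) (f (crossRatio y)) < ε / 3 := by
      refine hθf hη' ?_
      rw [Real.dist_eq]
      have h1 := hcr φ' x' hφ'
      have h2 : min (θ / 2) (ε / 3) ≤ θ / 2 := min_le_left _ _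
      linarith
    have h1 : ∀ᶠ δ in nhdsWithin 0 (Set.Ioi 0),
        dist (bondDomainCrossingProb R' δ) (f (crossRatio x')) < ε / 3 :=
      Metric.tendsto_nhds.1 hlim' _ (by positivity)
    filter_upwards [h1, hprob] with δ hδ1 hδ2
    rw [Real.dist_eq] at hδ1 hfclose ⊢
    have hδ2' : |bondDomainCrossingProb S δ - bondDomainCrossingProb R' δ| ≤ ε / 3 :=
      hδ2.trans (min_le_right _ _)
    have hsplit : bondDomainCrossingProb S δ - f (crossRatio y)
        = (bondDomainCrossingProb S δ - bondDomainCrossingProb R' δ)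
          + (bondDomainCrossingProb R' δ - f (crossRatio x'))
          + (f (crossRatio x') - f (crossRatio y)) := by ring
    rw [hsplit]
    calc |(bondDomainCrossingProb S δ - bondDomainCrossingProb R' δ)
          + (bondDomainCrossingProb R' δ - f (crossRatio x'))
          + (f (crossRatio x') - f (crossRatio y))|
        ≤ |bondDomainCrossingProb S δ - bondDomainCrossingProb R' δ|
          + |bondDomainCrossingProb R' δ - f (crossRatio x')|
          + |f (crossRatio x') - f (crossRatio y)| := abs_add_three _ _ _
      _ < ε := by linarith
  -- Step 2: an arbitrary rectangle is a translate of one with closure in `ℍ`.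
  intro R φ x hφ
  obtain ⟨r, hr⟩ := (Metric.isBounded_iff_subset_closedBall (0 : ℂ)).1 R.isBounded.closure
  obtain ⟨v, hv⟩ : ∃ v : ℂ, v = ((r + 1 : ℝ) : ℂ) * Complex.I := ⟨_, rfl⟩
  have hd : DifferentiableOn ℂ (fun z : ℂ ↦ z + v) R.carrier :=
    (differentiable_id.add_const v).differentiableOn
  have hi : Set.InjOn (fun z : ℂ ↦ z + v) R.carrier := (add_left_injective v).injOn
  have hc : ContinuousOn (fun z : ℂ ↦ z + v) (closure R.carrier) :=
    (continuous_id.add continuous_const).continuousOn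
  have hcl : closure (MarkedDomain.translate R v).carrier ⊆ upperHalfPlaneSet := by
    rw [MarkedDomain.carrier_translate, closure_image_of_isBounded R.isBounded hc]
    rintro _ ⟨z, hz, rfl⟩
    have hzr : ‖z‖ ≤ r := by simpa using hr hz
    have him : -r ≤ z.im := (abs_le.1 ((Complex.abs_im_le_norm z).trans hzr)).1
    have hvim : (z + v).im = z.im + (r + 1) := by simp [hv]
    show 0 < (z + v).im
    rw [hvim]
    linarith
  have hSlim := key _ hcl
  have hψ : (MarkedDomain.translate R v).IsUniformizing
      (φ.trans (ConformalEquiv.ofInjOn (fun z : ℂ ↦ z + v) R.isOpen hd hi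
        (MarkedDomain.carrier_translate R v).symm)) x :=
    hφ.image_data hd hi hc (MarkedDomain.carrier_translate R v) (MarkedDomain.pt_translate R v)
  exact hT R v _ (hSlim _ x hψ)

/-- **The crux BY NAME from the two stubs** (depends on `sorryAx` ONLY through `Holds.stub_translate`
and `Holds.stub_tubeSurgery` — this line certifies mechanically that the handles ARE the stub
statements). -/
theorem TubeReduction_proof :
    Summit.CriticalPhenomena.CardyFormulaZ2.Theses.CardyCapacityWard.TubeReduction :=
  TubeReduction_of Holds.stub_translate Holds.stub_tubeSurgery

end Summit.CriticalPhenomena.CardyFormulaZ2.Cruxes.TubeReduction.Birth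

end
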